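import Summits.KontsevichZagierPeriods.KontsevichZagierPeriods.Theorems.ValuedFieldSpecialisationParametricLiftingElementaryNetFibred
import Summits.KontsevichZagierPeriods.KontsevichZagierPeriods.Theorems.ValuedFieldSpecialisationCTConstructionDilateTyped

/-!
# Route ValuedFieldSpecialisation — crux `CTConstruction`: a sorted typed family is an elementary product

Helper toward crux stmt-KontsevichZagierPeriods-3495 (`CTConstruction`), line `registered`, stub
`stub_sorted_typed_elementary` of the lead's "dilation elimination" (pure-log phase). A **typed
elementary family** `R : KZ.IntegralRep (B + d + 2)` has coordinates `z = (s, u, t, w)`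
(`s = z 0` the parameter, `u = z 1`, the typed block `t : Fin B → ℝ` at the indices
`(Fin.castAdd d j).succ.succ`, `w : Fin d → ℝ` at the indices `(Fin.natAdd B l).succ.succ`),
domain `0 < s < 1`, `0 < u`, `u ^ Q * s ^ p < 1`, `κ j * s ^ (e j) ≤ t j ≤ 1`, `w ∈ r.domain`,
and integrand `∏ (t j)⁻¹ * r.integrand w`. A **sorted** typed family has block `B = b + k`: first
`b` coordinates of type `(1, 1)` (`t ∈ [s, 1]`), then `k` coordinates of type `(μ, 0)`
(`t ∈ [μ, 1]`). Such a family IS, after the relabelling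
`Fin ((b + k) + d + 2) ≃ Fin (b + (k + d) + 2)` of the same underlying naturals (`finCongr`), the
route's ELEMENTARY divergent product `P(p, Q, b, k + d, L_k × r)` over the Fubini product of the
log-power box `L_k = ([μ, 1]^k, ∏ t_j⁻¹)` with `r`: the `k` box coordinates are joined to `w`
(`Fin.forall_fin_add`, `Fin.prod_univ_add`, `KZ.IntegralRep.prod_integrand_eq`). The relabelling
fixes the parameter index `0`, so it is a FIBRED move
(`of_sub_of_reindex_mem_fibredRelations_of_pos`): `[R] − [R.reindex e] ∈ KZ.fibredRelations`.

Sources: M. Kontsevich, D. Zagier, *Periods* (2001), §1.2 (rule (2), change of variables), §4.1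
(Fubini product). No new definitions.
-/

noncomputable section

namespace Summit.KontsevichZagierPeriods.ValuedFieldSpecialisation

open MeasureTheory Set Filter
open Literature.NumberTheory.Transcendental Literature.NumberTheory.Transcendental.KZ

/-- **The relabelling `Fin ((b + k) + d + 2) ≃ Fin (b + (k + d) + 2)` along the identity of the
underlying naturals**, together with where it sends the coordinates of a sorted typed family: the
parameter `0 ↦ 0`, `1 ↦ 1`, the `(1, 1)`-block `j + 2 ↦ j + 2`, the `(μ, 0)`-block
`b + i + 2 ↦ b + i + 2` (now the first `k` coordinates of the factor `L_k × r`) and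
`b + k + l + 2 ↦ b + (k + l) + 2`. [folklore] -/
theorem exists_sortedEquiv (b k d : ℕ) :
    ∃ e : Fin (b + k + d + 1 + 1) ≃ Fin (b + (k + d) + 1 + 1),
      (∀ i, ((e i : Fin _) : ℕ) = i) ∧ e 0 = 0 ∧ e 1 = 1 ∧
      (∀ j : Fin b, e ((Fin.castAdd d (Fin.castAdd k j)).succ.succ) =
        (Fin.castAdd (k + d) j).succ.succ) ∧
      (∀ i : Fin k, e ((Fin.castAdd d (Fin.natAdd b i)).succ.succ) =
        (Fin.natAdd b (Fin.castAdd d i)).succ.succ) ∧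
      (∀ l : Fin d, e ((Fin.natAdd (b + k) l).succ.succ) =
        (Fin.natAdd b (Fin.natAdd k l)).succ.succ) := by
  obtain ⟨e, he⟩ :
      ∃ e : Fin (b + k + d + 1 + 1) ≃ Fin (b + (k + d) + 1 + 1), ∀ i, ((e i : Fin _) : ℕ) = i :=
    ⟨finCongr (by omega), fun i => rfl⟩
  refine ⟨e, he, Fin.ext (by rw [he]; simp), Fin.ext (by rw [he]; simp), fun j => Fin.ext ?_,
    fun i => Fin.ext ?_, fun l => Fin.ext ?_⟩
  · rw [he]; simp
  · rw [he]; simp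
  · rw [he]; simp only [Fin.val_succ, Fin.val_natAdd]; omega

/-- **Stub `stub_sorted_typed_elementary`** (pure-log phase of dilation elimination). Let `R` be
the SORTED typed elementary family over `r` with block `b + k`: `b` coordinates of type `(1, 1)`
(`1 * s ^ 1 ≤ t j ≤ 1`) followed by `k` coordinates of type `(μ, 0)` (`μ * s ^ 0 ≤ t j ≤ 1`), and
let `L_k = ([μ, 1]^k, ∏ t_j⁻¹)` be the log-power box. Then there is an elementary divergent product
`P` with data `(p, Q, b, L_k × r)` (domain `0 < s < 1`, `0 < u`, `u ^ Q * s ^ p < 1`,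
`s ≤ y_j ≤ 1`, `w ∈ (L_k × r).domain`; integrand `∏ y_j⁻¹ · (L_k ⊗ r) w`) with
`[R] − [P] ∈ KZ.fibredRelations`. Proof: `P := R.reindex e` for the relabelling `e` of
`exists_sortedEquiv` (same underlying naturals); relabelling fixing the parameter index is a fibred
move (`of_sub_of_reindex_mem_fibredRelations_of_pos`), and the data of `R.reindex e` are those of
the elementary product on the nose: domains through their coordinate forms (`typedDomain_eq`,
`elementaryDomain_eq`, `Fin.forall_fin_add`, `1 * s ^ 1 = s`, `μ * s ^ 0 = μ`), integrands by
`KZ.IntegralRep.prod_integrand_eq` and `Fin.prod_univ_add`.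
[Kontsevich–Zagier 2001, §1.2 rule (2), §4.1] [folklore] -/
theorem stub_sorted_typed_elementary : ∀ (Q p b k d : ℕ) (μ : ℚ) (r : Literature.NumberTheory.Transcendental.KZ.IntegralRep d) (Lk : Literature.NumberTheory.Transcendental.KZ.IntegralRep k) (R : Literature.NumberTheory.Transcendental.KZ.IntegralRep (b + k + d + 1 + 1)), 0 < μ → μ ≤ 1 → Lk.domain = {t | ∀ j, (μ : ℝ) ≤ t j ∧ t j ≤ 1} → Lk.integrand = (fun t => ∏ j, (t j)⁻¹) → R.domain = {z | ∃ (s u : ℝ) (t : Fin (b + k) → ℝ) (w : Fin d → ℝ), z = Matrix.vecCons s (Matrix.vecCons u (Fin.append t w)) ∧ 0 < s ∧ s < 1 ∧ 0 < u ∧ u ^ Q * s ^ p < 1 ∧ (∀ j, ((Fin.append (fun _ : Fin b => (1 : ℚ)) (fun _ : Fin k => μ) j : ℚ) : ℝ) * s ^ (Fin.append (fun _ : Fin b => (1 : ℕ)) (fun _ : Fin k => 0) j) ≤ t j ∧ t j ≤ 1) ∧ w ∈ r.domain} → R.integrand = (fun z => (∏ j : Fin (b + k), (z (Fin.castAdd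 d j).succ.succ)⁻¹) * r.integrand (fun l : Fin d => z (Fin.natAdd (b + k) l).succ.succ)) → ∃ P : Literature.NumberTheory.Transcendental.KZ.IntegralRep (b + (k + d) + 1 + 1), P.domain = {z | ∃ (s u : ℝ) (y : Fin b → ℝ) (w : Fin (k + d) → ℝ), z = Matrix.vecCons s (Matrix.vecCons u (Fin.append y w)) ∧ 0 < s ∧ s < 1 ∧ 0 < u ∧ u ^ Q * s ^ p < 1 ∧ (∀ j, s ≤ y j ∧ y j ≤ 1) ∧ w ∈ (Lk.prod r).domain} ∧ P.integrand = (fun z => (∏ j : Fin b, (z (Fin.castAdd (k + d) j).succ.succ)⁻¹) * (Lk.prod r).integrand (fun l : Fin (k + d) => z (Fin.natAdd b l).succ.succ)) ∧ Literature.NumberTheory.Transcendental.KZ.of R - Literature.NumberTheory.Transcendental.KZ.of P ∈ Literature.NumberTheory.Transcendental.KZ.fibredRelations := by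
  intro Q p b k d μ r Lk R _ _ hLk hLki hRd hRi
  obtain ⟨e, he, he0, he1, hey, heη, hew⟩ := exists_sortedEquiv b k d
  refine ⟨R.reindex e, ?_, ?_, of_sub_of_reindex_mem_fibredRelations_of_pos (by omega) R e (he _)⟩
  · -- the domains agree: compare coordinate forms
    rw [IntegralRep.reindex_domain, hRd,
      typedDomain_eq Q p (b + k)
        (fun j => ((Fin.append (fun _ : Fin b => (1 : ℚ)) (fun _ : Fin k => μ) j : ℚ) : ℝ))
        (Fin.append (fun _ : Fin b => (1 : ℕ)) (fun _ : Fin k => 0)) r,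
      elementaryDomain_eq p Q b (Lk.prod r)]
    ext z
    simp only [mem_setOf_eq, Fin.forall_fin_add, Fin.append_left, Fin.append_right, Rat.cast_one,
      one_mul, pow_one, pow_zero, mul_one, he0, he1, hey, heη, hew, IntegralRep.prod_domain,
      IntegralRep.mem_prodDomain, hLk, and_assoc]
  · -- the integrands agree everywhere
    rw [IntegralRep.reindex_integrand, hRi, IntegralRep.prod_integrand_eq]
    funext z
    simp only [IntegralRep.prodFun_apply, hLki, Fin.prod_univ_add, hey, heη, hew, mul_assoc]

end Summit.KontsevichZagierPeriods.ValuedFieldSpecialisation
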